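import Mathlib
import Literature.Analysis.ODE.RegularSingularScalarSystem
import Literature.Analysis.ODE.RegularSingularSharpRadius
import Literature.Analysis.ODE.FrobeniusSeriesTruncation
import HarnessLib

/-!
# Power-series solutions at an ORDINARY point of `y″ + P(x) y′ + Q(x) y = 0`: the step lemma of
# validated analytic continuation (both solutions, derivative at the centre, certified tail)

Topic `Literature/Analysis/ODE` (namespace `Literature.Analysis.ODE`). The tree's Frobenius files treat a
singularity of the first kind, `x y″ + p(x) y′ + q(x) y = 0` (`RegularSingularScalarSystem.lean`,
`RegularSingularAnalyticBranch(Solution).lean`, `RegularSingularSharpRadius.lean`). An ORDINARY point — `P`, `Q`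
analytic at the centre — is the degenerate case `p = x P`, `q = x Q` (`p₀ = q₀ = 0`, indicial exponents `{0, 1}`, no
logarithm, BOTH initial values `(y(0), y′(0)) = (y₀, y₁)` free): the classical theorem that at an ordinary point every
solution is analytic with radius at least that of the coefficients, its Taylor coefficients being generated by the
recursion obtained by inserting the series [cite: CoddingtonLevinson1955, Ch. 3 §8 / Ch. 4 §3]
[cite: Hartman2002, Ch. IV §12 (12.12)]. This file packages that case in the QUANTITATIVE shape used by kernel-checked
analytic continuation (the «Taylor series method with certified remainder» for linear equations with rational
coefficients: exact recurrences for the jets, a geometric tail from a majorant — the form in which validated ODE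
solvers for linear/holonomic equations certify their steps, cf. Mezzarobba's NumGfun / ore_algebra.analytic and the
radii-polynomial literature; here everything is proved from the tree's majorant theorems, no named facts):

* `mulXCoeff pt` — the coefficients of `x · P(x)` from those of `P` (`p₀ = 0`, `p_{k+1} = P_k`);
* `IsOrdinaryPointData pt qt P Q a K ρ₀` — the hypotheses: `P(x) = Σ Pₖ xᵏ`, `Q(x) = Σ Qₖ xᵏ` on `‖x‖ < ρ₀` with
  `‖Pₖ‖, ‖Qₖ‖ ≤ K aᵏ` (ALL `k`); `IsOrdinaryPointData.isFrobeniusData` — the system `x v′ = M(x) v`, `v = (y, y′)`,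
  of `RegularSingularScalarSystem.lean` with `pc = mulXCoeff pt`, `qc = mulXCoeff qt` satisfies `IsFrobeniusData`
  with `Rₙ = n⁻¹`, `c = 1`, `K_F = 2K/a + 1/a`;
* `ordCoeff pt qt y₀ y₁ n ∈ 𝕜 × 𝕜` — the Taylor coefficients of `(y, y′)` through `(y₀, y₁)` (= `frobeniusCoeff`),
  with THE RECURSION in closed form (`ordCoeff_succ`):
  `(n+1) v_{n+1} = ((v_n)₂, −Σ_{k≤n} (Q_k (v_{n−k})₁ + P_k (v_{n−k})₂))` — what a checker iterates in exact or
  interval arithmetic — and LINEARITY in `(y₀, y₁)` (`ordCoeff_linear`: two basis jets give all);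
* `IsOrdinaryPointData.norm_ordCoeff_le_of_jet` — the SHARP coefficient bound from a finite jet
  (`norm_frobeniusCoeff_le_of_jet` with the constants of this case): any `μ > a`, `B ≥ ‖(y₀, y₁)‖`,
  `‖v_n‖ ≤ B μⁿ` for `n < N` and `(2K + 1) B ≤ N B (μ − a)` give `‖v_n‖ ≤ B μⁿ` for all `n`;
* `IsOrdinaryPointData.hasDerivAt_ordSol` — THE STEP LEMMA: under any proven bound `‖v_n‖ ≤ B μⁿ` (`μ ≥ a`), at
  every `x` with `‖x‖ < ρ₀`, `μ‖x‖ < 1` — INCLUDING THE CENTRE `x = 0` — the sum `ordSol = Σ xⁿ vₙ = (y, y′)` has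
  `HasDerivAt y (y′ x) x` and `HasDerivAt y′ (−Q(x) y(x) − P(x) y′(x)) x`, with `(y, y′)(0) = (y₀, y₁)`
  (`ordSol_zero`); at `x ≠ 0` this is the tree's `frobeniusSol_ode_of_bound` divided by `x`, at `x = 0` the
  derivative series is evaluated (`v₁ = (y₁, −Q₀ y₀ − P₀ y₁)`);
* `norm_ordSol_sub_sum_le` — THE CERTIFIED TAIL (via `FrobeniusSeriesTruncation.norm_tsum_pow_smul_sub_sum_le`):
  `‖(y, y′)(x) − Σ_{n<N} xⁿ vₙ‖ ≤ B (μ‖x‖)^N / (1 − μ‖x‖)`; `ordSol_linear` — superposition.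

So one analytic-continuation STEP of a linear second-order equation is: check the jet inequalities (finite, exact),
conclude the bound for all `n`, read off `(y, y′)(h)` within the tail radius — for every initial vector at once by
linearity. Rational `P`, `Q` enter through `RationalTaylorMajorant.lean` (`ratTaylor_of_natDegree_le`), see
the companion certificate file `Literature/Computation/Certificates/LinearODETaylorCertificate.lean` (kernel-checkable jets).

## References
* E. A. Coddington, N. Levinson, *Theory of Ordinary Differential Equations*, McGraw–Hill 1955, Ch. 3 §8 (linear
  systems with analytic coefficients: solutions analytic where the coefficients are), Ch. 4 §3 (the majorant method).
  Key `CoddingtonLevinson1955`.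
* P. Hartman, *Ordinary Differential Equations*, SIAM Classics 38 (2002), Ch. IV §12, (12.12) (method of undetermined
  coefficients). Key `Hartman2002`.
-/

noncomputable section

open Finset Filter Metric
open scoped Topology

namespace Literature.Analysis.ODE

variable {𝕜 : Type*} [RCLike 𝕜]

/-! ### Coefficient bookkeeping: `p = x P`, `q = x Q` -/

/-- The coefficients of `x · P(x)` in terms of those of `P`: `(xP)₀ = 0`, `(xP)_{k+1} = P_k`.
[cite: CoddingtonLevinson1955, Ch. 4 §3] -/
def mulXCoeff (pt : ℕ → 𝕜) : ℕ → 𝕜 := fun k => if k = 0 then 0 else pt (k - 1)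

/-- `(xP)₀ = 0`. [cite: CoddingtonLevinson1955, Ch. 4 §3] -/
@[simp] theorem mulXCoeff_zero (pt : ℕ → 𝕜) : mulXCoeff pt 0 = 0 := by simp [mulXCoeff]

/-- `(xP)_{k+1} = P_k`. [cite: CoddingtonLevinson1955, Ch. 4 §3] -/
@[simp] theorem mulXCoeff_succ (pt : ℕ → 𝕜) (k : ℕ) : mulXCoeff pt (k + 1) = pt k := by simp [mulXCoeff]

/-- `Σ xᵏ (xP)ₖ = x · P(x)` whenever `Σ xᵏ Pₖ = P(x)`. [cite: CoddingtonLevinson1955, Ch. 4 §3] -/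
theorem hasSum_mulXCoeff {pt : ℕ → 𝕜} {x Px : 𝕜} (h : HasSum (fun k => x ^ k * pt k) Px) :
    HasSum (fun k => x ^ k * mulXCoeff pt k) (x * Px) := by
  have h1 : HasSum (fun k => x ^ (k + 1) * mulXCoeff pt (k + 1)) (x * Px) := by
    simp only [mulXCoeff_succ, pow_succ', mul_assoc]
    exact h.mul_left x
  rw [← hasSum_nat_add_iff' 1]
  simpa [Finset.sum_range_one] using h1

/-! ### The data of an ordinary point -/

/-- The data of `y″ + P(x) y′ + Q(x) y = 0` at an ORDINARY point: `P(x) = Σ Pₖ xᵏ`, `Q(x) = Σ Qₖ xᵏ` on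
`‖x‖ < ρ₀`, with geometric coefficient bounds `‖Pₖ‖, ‖Qₖ‖ ≤ K aᵏ` for all `k` (`a = 1/ρ` for a radius `ρ` of a
Cauchy majorant; for rational `P, Q` supplied by `RationalTaylorMajorant.ratTaylor_of_natDegree_le`).
[cite: CoddingtonLevinson1955, Ch. 3 §8 and Ch. 4 §3] -/
structure IsOrdinaryPointData (pt qt : ℕ → 𝕜) (P Q : 𝕜 → 𝕜) (a K ρ₀ : ℝ) : Prop where
  /-- `0 < a` -/
  a_pos : 0 < a
  /-- `0 ≤ K` -/
  K_nonneg : 0 ≤ K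
  /-- `0 < ρ₀` -/
  ρ₀_pos : 0 < ρ₀
  /-- `‖Pₖ‖ ≤ K aᵏ` for all `k` -/
  norm_pt_le : ∀ k : ℕ, ‖pt k‖ ≤ K * a ^ k
  /-- `‖Qₖ‖ ≤ K aᵏ` for all `k` -/
  norm_qt_le : ∀ k : ℕ, ‖qt k‖ ≤ K * a ^ k
  /-- `P(x) = Σ xᵏ Pₖ` on `‖x‖ < ρ₀` -/
  hasSum_P : ∀ x : 𝕜, ‖x‖ < ρ₀ → HasSum (fun k => x ^ k * pt k) (P x)
  /-- `Q(x) = Σ xᵏ Qₖ` on `‖x‖ < ρ₀` -/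
  hasSum_Q : ∀ x : 𝕜, ‖x‖ < ρ₀ → HasSum (fun k => x ^ k * qt k) (Q x)

/-- **The Taylor coefficients** `vₙ = (yₙ, y′ₙ) ∈ 𝕜 × 𝕜` of `(y, y′)` through `(y, y′)(0) = (y₀, y₁)`: the Frobenius
coefficients of the system `x v′ = M(x) v` of `x y″ + (xP) y′ + (xQ) y = 0` (`RegularSingularScalarSystem.lean`).
[cite: Hartman2002, Ch. IV §12 (12.12)] -/
def ordCoeff (pt qt : ℕ → 𝕜) (y₀ y₁ : 𝕜) (n : ℕ) : 𝕜 × 𝕜 :=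
  frobeniusCoeff (scalarSysM (mulXCoeff pt) (mulXCoeff qt)) (fun _ => 0)
    (scalarSysR (mulXCoeff pt) (mulXCoeff qt)) (y₀, y₁) n

/-- **The solution** `(y, y′)(x) = Σ xⁿ vₙ` through `(y₀, y₁)` (meaningful on the disc of a proven coefficient bound).
[cite: Hartman2002, Ch. IV §12 (12.12)] -/
def ordSol (pt qt : ℕ → 𝕜) (y₀ y₁ : 𝕜) : 𝕜 → 𝕜 × 𝕜 :=
  frobeniusSol (scalarSysM (mulXCoeff pt) (mulXCoeff qt)) (fun _ => 0)
    (scalarSysR (mulXCoeff pt) (mulXCoeff qt)) (y₀, y₁)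

section Recursion

variable (pt qt : ℕ → 𝕜) (y₀ y₁ : 𝕜)

/-- `v₀ = (y₀, y₁)`. [cite: Hartman2002, Ch. IV §12 (12.12)] -/
@[simp] theorem ordCoeff_zero : ordCoeff pt qt y₀ y₁ 0 = (y₀, y₁) := by
  simp [ordCoeff]

/-- `(y, y′)(0) = (y₀, y₁)`. [cite: Hartman2002, Ch. IV §12 (12.12)] -/
@[simp] theorem ordSol_zero : ordSol pt qt y₀ y₁ 0 = (y₀, y₁) := by
  simp [ordSol, frobeniusSol_zero]

/-- `(y, y′)(x) = Σ' xⁿ • vₙ` (definitional unfolding). [cite: Hartman2002, Ch. IV §12 (12.12)] -/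
theorem ordSol_eq_tsum (x : 𝕜) : ordSol pt qt y₀ y₁ x = ∑' n, x ^ n • ordCoeff pt qt y₀ y₁ n := rfl

/-- At an ordinary point `Rₙ = (n − M₀)⁻¹ = n⁻¹ · 1` is a right inverse of `n − M₀ = n` (`n ≥ 1`). [cite: CoddingtonLevinson1955, Ch. 4 §3] -/
theorem scalarSysR_rightInverse_ord (n : ℕ) (hn : 1 ≤ n) (w : 𝕜 × 𝕜) :
    (n : 𝕜) • scalarSysR (mulXCoeff pt) (mulXCoeff qt) n w
      - scalarSysM (mulXCoeff pt) (mulXCoeff qt) 0 (scalarSysR (mulXCoeff pt) (mulXCoeff qt) n w) = w := by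
  refine scalarSysR_rightInverse _ _ (by omega) ?_ w
  rw [mulXCoeff_zero, add_zero]
  exact Nat.cast_ne_zero.2 (by omega)

/-- The compatibility condition `M₀ v₀ = 0` is automatic at an ordinary point (`M₀ = 0`). [cite: CoddingtonLevinson1955, Ch. 4 §3] -/
theorem scalarSysM_zero_ord (w : 𝕜 × 𝕜) : scalarSysM (mulXCoeff pt) (mulXCoeff qt) 0 w = 0 := by
  rw [scalarSysM_apply]
  simp

/-- **THE RECURSION** generating the Taylor coefficients of `(y, y′)` at an ordinary point:
`(n + 1) v_{n+1} = ((v_n)₂, −Σ_{k ≤ n} (Q_k (v_{n−k})₁ + P_k (v_{n−k})₂))`, i.e. `y_{n+1} = y′_n/(n+1)` and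
`(n+1) y′_{n+1} = −Σ_{k+l=n} (Q_k y_l + P_k y′_l)` — the coefficient identity of `y″ = −P y′ − Q y`.
[cite: Hartman2002, Ch. IV §12 (12.12)] [cite: CoddingtonLevinson1955, Ch. 3 §8] -/
theorem ordCoeff_succ (n : ℕ) :
    ((n : 𝕜) + 1) • ordCoeff pt qt y₀ y₁ (n + 1) =
      ((ordCoeff pt qt y₀ y₁ n).2,
        -∑ k ∈ range (n + 1), (qt k * (ordCoeff pt qt y₀ y₁ (n - k)).1 + pt k * (ordCoeff pt qt y₀ y₁ (n - k)).2)) := by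
  have h := frobeniusCoeff_antidiagonal (M := scalarSysM (mulXCoeff pt) (mulXCoeff qt)) (g := fun _ => 0)
    (R := scalarSysR (mulXCoeff pt) (mulXCoeff qt)) (v₀ := (y₀, y₁)) (scalarSysR_rightInverse_ord pt qt)
    (by rw [scalarSysM_zero_ord, add_zero]) (n + 1)
  simp only [add_zero] at h
  have hc : ((n + 1 : ℕ) : 𝕜) = (n : 𝕜) + 1 := by push_cast; ring
  rw [hc] at h
  unfold ordCoeff
  rw [h, Finset.Nat.sum_antidiagonal_eq_sum_range_succ_mk]
  ext
  · -- first component: only `k = 1` contributes, with `(v_n)₂`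
    rw [Prod.fst_sum]
    simp only [scalarSysM_apply]
    rw [Finset.sum_eq_single 1]
    · simp
    · intro k _ hk
      simp [hk]
    · intro h1
      exact absurd (Finset.mem_range.2 (by omega)) h1
  · -- second component: drop the `k = 0` term (`P₀ = Q₀ = 0` after the shift) and reindex
    rw [Prod.snd_sum]
    simp only [scalarSysM_apply]
    rw [Finset.sum_range_succ' _ (n + 1)]
    simp only [mulXCoeff_zero, mulXCoeff_succ, neg_zero, zero_mul, sub_zero, add_zero,
      Nat.succ_sub_succ_eq_sub]
    rw [← Finset.sum_neg_distrib]
    refine Finset.sum_congr rfl fun k _ => ?_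
    ring

/-- LINEARITY of the Frobenius coefficients in the initial vector for a homogeneous system (`g = 0`). [cite: CoddingtonLevinson1955, Ch. 3 §8] -/
theorem frobeniusCoeff_linear {E : Type*} [NormedAddCommGroup E] [NormedSpace 𝕜 E] (M : ℕ → E →L[𝕜] E)
    (R : ℕ → E →L[𝕜] E) (c : 𝕜) (v w : E) (n : ℕ) :
    frobeniusCoeff M (fun _ => 0) R (c • v + w) n =
      c • frobeniusCoeff M (fun _ => 0) R v n + frobeniusCoeff M (fun _ => 0) R w n := by
  induction n using Nat.strong_induction_on with | _ n ih => ?_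
  rcases Nat.eq_zero_or_pos n with rfl | hn
  · simp
  · rw [frobeniusCoeff_of_ne_zero M _ R _ hn.ne', frobeniusCoeff_of_ne_zero M _ R v hn.ne',
      frobeniusCoeff_of_ne_zero M _ R w hn.ne']
    simp only [add_zero]
    have hs : ∑ k ∈ range n, M (n - k) (frobeniusCoeff M (fun _ => 0) R (c • v + w) k) =
        c • ∑ k ∈ range n, M (n - k) (frobeniusCoeff M (fun _ => 0) R v k) +
          ∑ k ∈ range n, M (n - k) (frobeniusCoeff M (fun _ => 0) R w k) := by
      rw [Finset.smul_sum, ← Finset.sum_add_distrib]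
      refine Finset.sum_congr rfl fun k hk => ?_
      rw [ih k (Finset.mem_range.1 hk), map_add, map_smul]
    rw [hs, map_add, map_smul]

/-- **SUPERPOSITION of the jets**: `vₙ(y₀, y₁) = y₀ • vₙ(1, 0) + y₁ • vₙ(0, 1)`. [cite: CoddingtonLevinson1955, Ch. 3 §8] -/
theorem ordCoeff_linear (n : ℕ) :
    ordCoeff pt qt y₀ y₁ n = y₀ • ordCoeff pt qt 1 0 n + y₁ • ordCoeff pt qt 0 1 n := by
  unfold ordCoeff
  have e : ((y₀, y₁) : 𝕜 × 𝕜) = y₀ • ((1 : 𝕜), (0 : 𝕜)) + (y₁ • ((0 : 𝕜), (1 : 𝕜)) + 0) := by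
    ext <;> simp
  have e2 : (y₁ • ((0 : 𝕜), (1 : 𝕜)) : 𝕜 × 𝕜) = y₁ • ((0 : 𝕜), (1 : 𝕜)) + 0 := by simp
  rw [e, frobeniusCoeff_linear, add_zero, e2, frobeniusCoeff_linear]
  have h0 : ∀ m, frobeniusCoeff (scalarSysM (mulXCoeff pt) (mulXCoeff qt)) (fun _ => (0 : 𝕜 × 𝕜))
      (scalarSysR (mulXCoeff pt) (mulXCoeff qt)) 0 m = 0 := by
    intro m
    induction m using Nat.strong_induction_on with | _ m ih => ?_
    rcases Nat.eq_zero_or_pos m with rfl | hm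
    · simp
    · rw [frobeniusCoeff_of_ne_zero _ _ _ _ hm.ne']
      simp only [add_zero]
      rw [Finset.sum_eq_zero fun k hk => by rw [ih k (Finset.mem_range.1 hk), map_zero], map_zero]
  rw [h0, add_zero]

end Recursion

/-! ### Series calculus: the certified tail -/

section Tail

variable {F : Type*} [NormedAddCommGroup F] [NormedSpace 𝕜 F] [CompleteSpace F]

variable (pt qt : ℕ → 𝕜) (y₀ y₁ : 𝕜)

/-- **THE CERTIFIED TAIL of the step**: under `‖vₙ‖ ≤ B μⁿ`, for `μ‖x‖ < 1`,
`‖(y, y′)(x) − Σ_{n<N} xⁿ vₙ‖ ≤ B (μ‖x‖)^N / (1 − μ‖x‖)` (sup norm on `𝕜 × 𝕜`: both components at once).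
[cite: CoddingtonLevinson1955, Ch. 4 §3] -/
theorem norm_ordSol_sub_sum_le {B μ : ℝ} (hB : ∀ n, ‖ordCoeff pt qt y₀ y₁ n‖ ≤ B * μ ^ n) (hμ : 0 ≤ μ)
    {x : 𝕜} (hx : μ * ‖x‖ < 1) (N : ℕ) :
    ‖ordSol pt qt y₀ y₁ x - ∑ n ∈ range N, x ^ n • ordCoeff pt qt y₀ y₁ n‖ ≤
      B * (μ * ‖x‖) ^ N / (1 - μ * ‖x‖) :=
  norm_tsum_pow_smul_sub_sum_le hB hμ hx N

/-- **SUPERPOSITION of the solutions** on the common disc of the two basis bounds: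
`(y, y′)(x; y₀, y₁) = y₀ • (y, y′)(x; 1, 0) + y₁ • (y, y′)(x; 0, 1)`. [cite: CoddingtonLevinson1955, Ch. 3 §8] -/
theorem ordSol_linear {B₁ B₂ μ : ℝ} (h₁ : ∀ n, ‖ordCoeff pt qt 1 0 n‖ ≤ B₁ * μ ^ n)
    (h₂ : ∀ n, ‖ordCoeff pt qt 0 1 n‖ ≤ B₂ * μ ^ n) (hμ : 0 ≤ μ) {x : 𝕜} (hx : μ * ‖x‖ < 1) :
    ordSol pt qt y₀ y₁ x = y₀ • ordSol pt qt 1 0 x + y₁ • ordSol pt qt 0 1 x := by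
  have hs₁ : Summable fun n => x ^ n • ordCoeff pt qt 1 0 n := (summable_norm_pow_smul h₁ hμ hx).of_norm
  have hs₂ : Summable fun n => x ^ n • ordCoeff pt qt 0 1 n := (summable_norm_pow_smul h₂ hμ hx).of_norm
  simp only [ordSol_eq_tsum]
  rw [← hs₁.tsum_const_smul y₀, ← hs₂.tsum_const_smul y₁, ← (hs₁.const_smul y₀).tsum_add (hs₂.const_smul y₁)]
  refine tsum_congr fun n => ?_
  rw [ordCoeff_linear pt qt y₀ y₁ n, smul_add, smul_comm y₀ (x ^ n), smul_comm y₁ (x ^ n)]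

end Tail

/-! ### The Frobenius data of an ordinary point and the sharp coefficient bound -/

namespace IsOrdinaryPointData

variable {pt qt : ℕ → 𝕜} {P Q : 𝕜 → 𝕜} {a K ρ₀ : ℝ}

/-- The shifted coefficients obey `‖(xP)ₖ‖ ≤ (K a⁻¹) aᵏ` for `k ≥ 1`. [cite: CoddingtonLevinson1955, Ch. 4 §3] -/
theorem norm_mulXCoeff_le (h : IsOrdinaryPointData pt qt P Q a K ρ₀) {c : ℕ → 𝕜}
    (hc : ∀ k : ℕ, ‖c k‖ ≤ K * a ^ k) (k : ℕ) (hk : 1 ≤ k) : ‖mulXCoeff c k‖ ≤ K * a⁻¹ * a ^ k := by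
  obtain ⟨j, rfl⟩ : ∃ j, k = j + 1 := ⟨k - 1, by omega⟩
  rw [mulXCoeff_succ, pow_succ, show K * a⁻¹ * (a ^ j * a) = K * a ^ j * (a⁻¹ * a) by ring,
    inv_mul_cancel₀ h.a_pos.ne', mul_one]
  exact hc j

/-- **The system of an ordinary point satisfies `IsFrobeniusData`** with `a`, `K_F = 2(K a⁻¹) + a⁻¹`, `G = 0`,
`c = max 1 ((‖0‖ + 1)/1) (= 1)` — `isFrobeniusData_scalarSys` with `μ = 1` (no resonance: `n + p₀ = n`) and the
trivially satisfied compatibility `q₀ y₀ + p₀ y₁ = 0`. [cite: CoddingtonLevinson1955, Ch. 4 §3] -/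
theorem isFrobeniusData (h : IsOrdinaryPointData pt qt P Q a K ρ₀) (y₀ y₁ : 𝕜) :
    IsFrobeniusData (scalarSysM (mulXCoeff pt) (mulXCoeff qt)) (fun _ => 0)
      (scalarSysR (mulXCoeff pt) (mulXCoeff qt)) (y₀, y₁) a (2 * (K * a⁻¹) + a⁻¹) 0
      (max 1 ((‖mulXCoeff qt 0‖ + 1) / 1)) := by
  refine isFrobeniusData_scalarSys (mulXCoeff pt) (mulXCoeff qt) h.a_pos
    (mul_nonneg h.K_nonneg (inv_nonneg.2 h.a_pos.le)) one_pos (h.norm_mulXCoeff_le h.norm_pt_le)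
    (h.norm_mulXCoeff_le h.norm_qt_le) (fun n _ => ?_) ?_
  · rw [mulXCoeff_zero, add_zero, RCLike.norm_natCast, one_mul]
  · simp

/-- The resolvent constant is `1` at an ordinary point. [cite: CoddingtonLevinson1955, Ch. 4 §3] -/
theorem frobC_eq_one : max 1 ((‖mulXCoeff qt 0‖ + 1) / 1) = (1 : ℝ) := by
  simp

/-- **SHARP COEFFICIENT BOUND FROM A JET** at an ordinary point: for any rate `μ > a` and `B ≥ ‖(y₀, y₁)‖`, if
`‖vₙ‖ ≤ B μⁿ` for `n < N` (a finite computation) and `(2K + 1) B ≤ N B (μ − a)`, then `‖vₙ‖ ≤ B μⁿ` for ALL `n`.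
[cite: CoddingtonLevinson1955, Ch. 4 §3] -/
theorem norm_ordCoeff_le_of_jet (h : IsOrdinaryPointData pt qt P Q a K ρ₀) {y₀ y₁ : 𝕜} {μ B : ℝ} {N : ℕ}
    (hμ : a < μ) (hB₀ : ‖(y₀, y₁)‖ ≤ B) (hjet : ∀ n : ℕ, n < N → ‖ordCoeff pt qt y₀ y₁ n‖ ≤ B * μ ^ n)
    (hN : (2 * K + 1) * B ≤ N * B * (μ - a)) (n : ℕ) : ‖ordCoeff pt qt y₀ y₁ n‖ ≤ B * μ ^ n := by
  have hF := h.isFrobeniusData y₀ y₁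
  have hμa : 0 < μ - a := sub_pos.2 hμ
  refine norm_frobeniusCoeff_le_of_jet hF.a_nonneg hF.K_nonneg hF.G_nonneg hF.c_nonneg hF.norm_M_le
    hF.norm_g_le hF.norm_R_le hμ hB₀ hjet ?_ n
  rw [frobC_eq_one, one_mul, add_zero]
  have ha := h.a_pos.ne'
  have e : (2 * (K * a⁻¹) + a⁻¹) * B * a / (μ - a) = (2 * K + 1) * B / (μ - a) := by
    field_simp
  rw [e, div_le_iff₀ hμa]
  exact hN

/-! ### The step lemma: the series solves the equation, also at the centre -/

/-- `P(0) = P₀` (the sum at the centre). [cite: CoddingtonLevinson1955, Ch. 3 §8] -/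
theorem apply_zero_eq (h : IsOrdinaryPointData pt qt P Q a K ρ₀) : P 0 = pt 0 ∧ Q 0 = qt 0 := by
  have hP := h.hasSum_P 0 (by simpa using h.ρ₀_pos)
  have hQ := h.hasSum_Q 0 (by simpa using h.ρ₀_pos)
  have e : ∀ c : ℕ → 𝕜, HasSum (fun k => (0 : 𝕜) ^ k * c k) (c 0) := fun c => by
    have := hasSum_single (f := fun k => (0 : 𝕜) ^ k * c k) 0 (fun k hk => by simp [zero_pow hk])
    simpa using this
  exact ⟨hP.unique (e pt), hQ.unique (e qt)⟩

/-- `v₁ = (y₁, −Q₀ y₀ − P₀ y₁)`. [cite: Hartman2002, Ch. IV §12 (12.12)] -/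
theorem ordCoeff_one (pt qt : ℕ → 𝕜) (y₀ y₁ : 𝕜) :
    ordCoeff pt qt y₀ y₁ 1 = (y₁, -(qt 0 * y₀ + pt 0 * y₁)) := by
  have h := ordCoeff_succ pt qt y₀ y₁ 0
  simp only [Nat.cast_zero, zero_add, one_smul, ordCoeff_zero, Finset.sum_range_one, Nat.sub_zero] at h
  exact h

/-- **THE STEP LEMMA (ordinary point).** Under `IsOrdinaryPointData pt qt P Q a K ρ₀` and ANY proven coefficient bound
`‖vₙ‖ ≤ B μⁿ` with `μ ≥ a`: at every `x` with `‖x‖ < ρ₀` and `μ‖x‖ < 1` — the centre `x = 0` included — the summed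
series `(y, y′) = ordSol` satisfies `HasDerivAt y (y′ x) x` and `HasDerivAt y′ (−Q(x) y(x) − P(x) y′(x)) x`: it is a
classical solution of `y″ + P y′ + Q y = 0` on the whole disc of the bound, through `(y₀, y₁)` (`ordSol_zero`).
[cite: CoddingtonLevinson1955, Ch. 3 §8 and Ch. 4 §3] -/
theorem hasDerivAt_ordSol (h : IsOrdinaryPointData pt qt P Q a K ρ₀) {y₀ y₁ : 𝕜} {B μ : ℝ}
    (hB : ∀ n, ‖ordCoeff pt qt y₀ y₁ n‖ ≤ B * μ ^ n) (haμ : a ≤ μ) {x : 𝕜} (hxρ : ‖x‖ < ρ₀)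
    (hx : μ * ‖x‖ < 1) :
    HasDerivAt (fun z => (ordSol pt qt y₀ y₁ z).1) ((ordSol pt qt y₀ y₁ x).2) x ∧
      HasDerivAt (fun z => (ordSol pt qt y₀ y₁ z).2)
        (-(Q x) * (ordSol pt qt y₀ y₁ x).1 - P x * (ordSol pt qt y₀ y₁ x).2) x := by
  have hF := h.isFrobeniusData y₀ y₁
  obtain ⟨-, hd, hode⟩ := hF.frobeniusSol_ode_of_bound hB haμ hx
  change HasDerivAt (ordSol pt qt y₀ y₁) _ x at hd
  change x • deriv (ordSol pt qt y₀ y₁) x =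
    (∑' k, x ^ k • scalarSysM (mulXCoeff pt) (mulXCoeff qt) k) (ordSol pt qt y₀ y₁ x)
      + ∑' k : ℕ, x ^ k • (0 : 𝕜 × 𝕜) at hode
  have hax : a * ‖x‖ < 1 := lt_of_le_of_lt (mul_le_mul_of_nonneg_right haμ (norm_nonneg x)) hx
  rw [tsum_scalarSysM_apply (mulXCoeff pt) (mulXCoeff qt) h.a_pos.le hF.norm_M_le' hax
      (hasSum_mulXCoeff (h.hasSum_P x hxρ)) (hasSum_mulXCoeff (h.hasSum_Q x hxρ)),
    tsum_congr (fun k => smul_zero (x ^ k)), tsum_zero, add_zero] at hode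
  set v := ordSol pt qt y₀ y₁ x with hv
  set D : 𝕜 × 𝕜 := ∑' n : ℕ, ((n : 𝕜) * x ^ (n - 1)) • ordCoeff pt qt y₀ y₁ n with hD_def
  -- the derivative `D` is `(y′(x), −Q y − P y′)`, at `x ≠ 0` by cancelling `x`, at `x = 0` by evaluation
  have hD : D = (v.2, -(Q x) * v.1 - P x * v.2) := by
    by_cases hx0 : x = 0
    · have hD1 : D = ordCoeff pt qt y₀ y₁ 1 := by
        rw [hD_def, tsum_eq_single 1]
        · simp [hx0]
        · intro n hn
          rcases Nat.lt_or_gt_of_ne hn with hn0 | hn2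
          · have : n = 0 := by omega
            simp [this]
          · have : x ^ (n - 1) = 0 := by rw [hx0]; exact zero_pow (by omega)
            simp [this]
      obtain ⟨hP0, hQ0⟩ := h.apply_zero_eq
      have hv0 : v = (y₀, y₁) := by rw [hv, hx0, ordSol_zero]
      rw [hD1, ordCoeff_one, hv0, hx0, hP0, hQ0]
      ext <;> simp; ring
    · have hdx : deriv (ordSol pt qt y₀ y₁) x = D := hd.deriv
      rw [hdx] at hode
      have e1 := congrArg Prod.fst hode
      have e2 := congrArg Prod.snd hode
      simp only [Prod.smul_fst, Prod.smul_snd, smul_eq_mul] at e1 e2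
      ext
      · exact mul_left_cancel₀ hx0 e1
      · refine mul_left_cancel₀ hx0 ?_
        rw [e2]; ring
  have hd' : HasDerivAt (ordSol pt qt y₀ y₁) (v.2, -(Q x) * v.1 - P x * v.2) x := hD ▸ hd
  exact ⟨(ContinuousLinearMap.fst 𝕜 𝕜 𝕜).hasFDerivAt.comp_hasDerivAt x hd',
    (ContinuousLinearMap.snd 𝕜 𝕜 𝕜).hasFDerivAt.comp_hasDerivAt x hd'⟩

end IsOrdinaryPointData

end Literature.Analysis.ODE

end
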